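import Summits.MatrixMultiplication.OmegaCensus.DihedralNoSumOfCubes
import Literature.RepresentationTheory.FiniteGroups.DihedralCharacterDegrees
import Literature.RepresentationTheory.FiniteGroups.DicyclicCharacterDegrees
import Literature.Computability.AlgebraicComplexity.CohnUmansTPPProofs
import HarnessLib

/-!
# No dihedral or dicyclic group beats the sum of the cubes — now against the tree's `Σ_χ χ(1)³`

ω-census, family (b3); cell `pub-omega` (unit `pub-omega-lit`, gen 15).  Framing: lottery ticket; floor = certified
bounds/negative ranges.  Companion of `DihedralNoSumOfCubes.lean`, which proves for every TPP triple `(S, T, U)` of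
`D_{2n} = DihedralGroup n` the volume bound `|S||T||U| < 4n − 4` (`n ≥ 4`) / `≤ 8` (`n = 3`) and compares it with the
sum of the cubes of the character degrees `Σ d³ = 4n − 2` (`n` odd) / `4n − 4` (`n` even) ONLY IN ITS DOCSTRING ("the
character-degree bookkeeping … stays in this docstring; the tree has no character table of `D_{2n}`").  For `n` odd the
tree now has `Σ_{χ ∈ Irr(D_{2n})} χ(1)³ = 4n − 2` as a theorem (`charDegreePowSum_dihedralGroup_odd_three`, James–Liebeck
§18.3 Case 1, `Literature/RepresentationTheory/FiniteGroups/DihedralCharacterDegrees.lean`), so the comparison becomes a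
kernel statement about the quantity `charDegreePowSum G 3` that Cohn–Umans 2003 Thm. 4.1 / CKSU 2005 Thm. 1.8 actually use:

* `tpp_volume_lt_charDegreePowSum_dihedral_odd` — for `n` odd, `n ≥ 3`, every TPP triple of `D_{2n}` has
  `|S||T||U| < Σ_χ χ(1)³`;
* `not_beats_sum_cubes_dihedral_odd` — hence the hypothesis `Σ_χ χ(1)³ < |S||T||U|` of
  `CKSU2005_thm18.omega_lt_three` ("beating the sum of the cubes", CKSU 2005 §2) is never met by a single TPP triple in
  a dihedral group `D_{2n}` with `n` odd (`n = 1`: `D₂ ≅ C₂` is abelian, volume `≤ |G| = Σ d³`; handled too).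

* `tpp_volume_lt_charDegreePowSum_dihedral_even` (`n` even, `n ≥ 4`, `Σ d³ = 4n − 4` = tree
  `charDegreePowSum_dihedralGroup_even_three`), `tpp_volume_le_four_dihedral_two` (`D₄` abelian) and the uniform
  **`not_beats_sum_cubes_dihedral`** (every `n ≥ 1`).

* `tpp_volume_lt_charDegreePowSum_quaternion` (dicyclic `T_{4n} = QuaternionGroup n`, `n ≥ 2`: `Σ d³ = 8n − 4` = tree
  `charDegreePowSum_quaternionGroup_three`, James–Liebeck Exercise 17.6, `DicyclicCharacterDegrees.lean`),
  `tpp_volume_le_four_quaternion_one` (`T_4 ≅ C_4` abelian) and **`not_beats_sum_cubes_quaternion`** (every `n ≥ 1`).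

0 named facts; 0 `sorry`.

References: Cohn–Kleinberg–Szegedy–Umans 2005, Thm. 1.8, §2 [CohnKleinbergSzegedyUmans2005]; James–Liebeck 2001, §18.3
[JamesLiebeck2001].
-/

noncomputable section

namespace Summit.MatrixMultiplication.OmegaCensus

open Literature.Combinatorics.Additive Literature.RepresentationTheory.FiniteGroups
  Literature.Computability.AlgebraicComplexity Finset

/-- **For `n` odd, `n ≥ 3`, every TPP triple of `D_{2n}` has `|S||T||U| < Σ_{χ ∈ Irr(D_{2n})} χ(1)³ = 4n − 2`**
(volume side: `DihedralNoSumOfCubes.lean` / `tpp_volume_le_dihedral`, `3|S||T||U| ≤ 8n`; character side: James–Liebeck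
§18.3, tree `charDegreePowSum_dihedralGroup_odd_three`). [cite: JamesLiebeck2001, §18.3]
[cite: CohnKleinbergSzegedyUmans2005, §2] -/
theorem tpp_volume_lt_charDegreePowSum_dihedral_odd {n : ℕ} (hn : Odd n) (h3 : 3 ≤ n)
    {S T U : Finset (DihedralGroup n)} (h : TripleProductProperty S T U) :
    ((S.card * T.card * U.card : ℕ) : ℝ) < charDegreePowSum (DihedralGroup n) 3 := by
  haveI : NeZero n := ⟨by omega⟩
  rw [charDegreePowSum_dihedralGroup_odd_three hn]
  have hv := tpp_volume_le_dihedral h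
  have hlt : S.card * T.card * U.card < 4 * n - 2 := by omega
  have hcast : ((4 * n - 2 : ℕ) : ℝ) = 4 * n - 2 := by
    rw [Nat.cast_sub (by omega), Nat.cast_mul]; norm_num
  rw [← hcast]
  exact_mod_cast hlt

/-- **A dihedral group `D_{2n}` with `n` odd never beats the sum of the cubes with a single TPP triple**: the hypothesis
`charDegreePowSum G 3 < |S||T||U|` of `CKSU2005_thm18.omega_lt_three` fails for every TPP triple of `DihedralGroup n`,
`n` odd (`n ≥ 3` by the previous theorem; `n = 1`: `D₂` is abelian of order `2`, `Σ d³ = 2 ≥ |S||T||U|` by the packing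
of a TPP triple into `G`, here via `tpp_volume_le_dihedral`: `3|S||T||U| ≤ 8`). [cite: CohnKleinbergSzegedyUmans2005, §2]
[cite: JamesLiebeck2001, §18.3] -/
theorem not_beats_sum_cubes_dihedral_odd {n : ℕ} (hn : Odd n) {S T U : Finset (DihedralGroup n)}
    (h : TripleProductProperty S T U) :
    ¬ charDegreePowSum (DihedralGroup n) 3 < ((S.card * T.card * U.card : ℕ) : ℝ) := by
  haveI : NeZero n := ⟨hn.pos.ne'⟩
  rw [not_lt]
  by_cases h3 : 3 ≤ n
  · exact (tpp_volume_lt_charDegreePowSum_dihedral_odd hn h3 h).le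
  · -- `n` odd and `n < 3`: `n = 1`, `Σ d³ = 2`, `3|S||T||U| ≤ 8`
    obtain ⟨m, rfl⟩ := hn
    have hm : m = 0 := by omega
    subst hm
    rw [charDegreePowSum_dihedralGroup_odd_three ⟨0, rfl⟩]
    have hv := tpp_volume_le_dihedral h
    have hle : S.card * T.card * U.card ≤ 2 := by omega
    have : ((S.card * T.card * U.card : ℕ) : ℝ) ≤ 2 := by exact_mod_cast hle
    push_cast at this ⊢
    linarith

/-- **For `n` even, `n ≥ 4`, every TPP triple of `D_{2n}` has `|S||T||U| < Σ_{χ ∈ Irr(D_{2n})} χ(1)³ = 4n − 4`**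
(volume side `tpp_volume_lt_sum_cubes_dihedral`; character side James–Liebeck §18.3 Case 2, tree
`charDegreePowSum_dihedralGroup_even_three`). [cite: JamesLiebeck2001, §18.3] [cite: CohnKleinbergSzegedyUmans2005, §2] -/
theorem tpp_volume_lt_charDegreePowSum_dihedral_even {n : ℕ} (hn : Even n) (h4 : 4 ≤ n)
    {S T U : Finset (DihedralGroup n)} (h : TripleProductProperty S T U) :
    ((S.card * T.card * U.card : ℕ) : ℝ) < charDegreePowSum (DihedralGroup n) 3 := by
  haveI : NeZero n := ⟨by omega⟩
  rw [charDegreePowSum_dihedralGroup_even_three hn]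
  have hlt := tpp_volume_lt_sum_cubes_dihedral h4 h
  have hcast : ((4 * n - 4 : ℕ) : ℝ) = 4 * n - 4 := by
    rw [Nat.cast_sub (by omega), Nat.cast_mul]; norm_num
  rw [← hcast]
  exact_mod_cast hlt

/-- `D₄` (`n = 2`, the Klein four-group) is abelian, so a TPP triple has `|S||T||U| ≤ |D₄| = 4`
(Cohn–Umans 2003, Lemma 3.1; tree `RealizesTPP.mul_mul_le_card` transported along `DihedralGroup.commutative_iff`).
[cite: CohnUmans2003, Lemma 3.1] -/
theorem tpp_volume_le_four_dihedral_two {S T U : Finset (DihedralGroup 2)} (h : TripleProductProperty S T U) :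
    S.card * T.card * U.card ≤ 4 := by
  have hcomm : ∀ a b : DihedralGroup 2, a * b = b * a :=
    fun a b => (DihedralGroup.commutative_iff.mpr (Or.inr rfl)).is_comm.comm a b
  have hr : RealizesTPP (DihedralGroup 2) S.card T.card U.card := ⟨S, T, U, rfl, rfl, rfl, h⟩
  have := @RealizesTPP.mul_mul_le_card (DihedralGroup 2)
    { toGroup := inferInstance, mul_comm := hcomm } _ _ _ _ hr
  simpa [DihedralGroup.card] using this

/-- **No dihedral group beats the sum of the cubes with a single TPP triple** — every `n ≥ 1`, against the tree's
`charDegreePowSum`: the hypothesis `Σ_χ χ(1)³ < |S||T||U|` of `CKSU2005_thm18.omega_lt_three` fails for every TPP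
triple of `DihedralGroup n` (`n` odd: `not_beats_sum_cubes_dihedral_odd`; `n` even `≥ 4`: the previous theorem; `n = 2`:
`D₄` abelian, `|S||T||U| ≤ 4 = Σ d³`).  The census sub-family "single TPP triples in dihedral groups" is closed at kernel
grade on both sides. [cite: CohnKleinbergSzegedyUmans2005, §2] [cite: JamesLiebeck2001, §18.3] -/
theorem not_beats_sum_cubes_dihedral {n : ℕ} [NeZero n] {S T U : Finset (DihedralGroup n)}
    (h : TripleProductProperty S T U) :
    ¬ charDegreePowSum (DihedralGroup n) 3 < ((S.card * T.card * U.card : ℕ) : ℝ) := by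
  rcases Nat.even_or_odd n with hn | hn
  · rw [not_lt]
    by_cases h4 : 4 ≤ n
    · exact (tpp_volume_lt_charDegreePowSum_dihedral_even hn h4 h).le
    · -- `n` even, `0 < n < 4`: `n = 2`
      obtain ⟨m, rfl⟩ := hn
      have hm : m = 1 := by
        have := NeZero.ne (m + m)
        omega
      subst hm
      rw [charDegreePowSum_dihedralGroup_even_three ⟨1, rfl⟩]
      have hle := tpp_volume_le_four_dihedral_two h
      have : ((S.card * T.card * U.card : ℕ) : ℝ) ≤ 4 := by exact_mod_cast hle
      push_cast at this ⊢
      linarith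
  · exact not_beats_sum_cubes_dihedral_odd hn h

/-- **For `n ≥ 2` every TPP triple of the dicyclic group `T_{4n} = QuaternionGroup n` has
`|S||T||U| < Σ_{χ ∈ Irr(T_{4n})} χ(1)³ = 8n − 4`** (volume side `tpp_volume_lt_sum_cubes_quaternion`; character side
James–Liebeck Exercise 17.6 / solution p. 420, tree `charDegreePowSum_quaternionGroup_three`).
[cite: JamesLiebeck2001, Exercise 17.6 (solution, p. 420)] [cite: CohnKleinbergSzegedyUmans2005, §2] -/
theorem tpp_volume_lt_charDegreePowSum_quaternion {n : ℕ} (hn : 2 ≤ n)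
    {S T U : Finset (QuaternionGroup n)} (h : TripleProductProperty S T U) :
    ((S.card * T.card * U.card : ℕ) : ℝ) < charDegreePowSum (QuaternionGroup n) 3 := by
  haveI : NeZero n := ⟨by omega⟩
  rw [charDegreePowSum_quaternionGroup_three]
  have hlt := tpp_volume_lt_sum_cubes_quaternion hn h
  have hcast : ((8 * n - 4 : ℕ) : ℝ) = 8 * n - 4 := by
    rw [Nat.cast_sub (by omega), Nat.cast_mul]; norm_num
  rw [← hcast]
  exact_mod_cast hlt

/-- `T_4 = QuaternionGroup 1` is cyclic of order `4` (Mathlib `quaternionGroup_one_isCyclic`), hence abelian, so a TPP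
triple has `|S||T||U| ≤ |T_4| = 4` (Cohn–Umans 2003, Lemma 3.1; tree `RealizesTPP.mul_mul_le_card`).
[cite: CohnUmans2003, Lemma 3.1] -/
theorem tpp_volume_le_four_quaternion_one {S T U : Finset (QuaternionGroup 1)} (h : TripleProductProperty S T U) :
    S.card * T.card * U.card ≤ 4 := by
  haveI : IsCyclic (QuaternionGroup 1) := QuaternionGroup.quaternionGroup_one_isCyclic
  have hr : RealizesTPP (QuaternionGroup 1) S.card T.card U.card := ⟨S, T, U, rfl, rfl, rfl, h⟩
  have := @RealizesTPP.mul_mul_le_card (QuaternionGroup 1) IsCyclic.commGroup _ _ _ _ hr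
  simpa [QuaternionGroup.card] using this

/-- **No dicyclic group beats the sum of the cubes with a single TPP triple** — every `n ≥ 1`, against the tree's
`charDegreePowSum`: the hypothesis `Σ_χ χ(1)³ < |S||T||U|` of `CKSU2005_thm18.omega_lt_three` fails for every TPP triple
of `QuaternionGroup n` (`n ≥ 2`: the previous theorems; `n = 1`: `T_4` abelian, `|S||T||U| ≤ 4 = Σ d³`).  Together with
`not_beats_sum_cubes_dihedral` the census sub-family "single TPP triples in dihedral / dicyclic groups" of
`DihedralNoSumOfCubes.lean` is closed at kernel grade on both sides. [cite: CohnKleinbergSzegedyUmans2005, §2]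
[cite: JamesLiebeck2001, Exercise 17.6 (solution, p. 420)] -/
theorem not_beats_sum_cubes_quaternion {n : ℕ} [NeZero n] {S T U : Finset (QuaternionGroup n)}
    (h : TripleProductProperty S T U) :
    ¬ charDegreePowSum (QuaternionGroup n) 3 < ((S.card * T.card * U.card : ℕ) : ℝ) := by
  rw [not_lt]
  by_cases h2 : 2 ≤ n
  · exact (tpp_volume_lt_charDegreePowSum_quaternion h2 h).le
  · have hn : n = 1 := by
      have := NeZero.ne n
      omega
    subst hn
    rw [charDegreePowSum_quaternionGroup_three]
    have hle := tpp_volume_le_four_quaternion_one h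
    have : ((S.card * T.card * U.card : ℕ) : ℝ) ≤ 4 := by exact_mod_cast hle
    push_cast at this ⊢
    linarith

end Summit.MatrixMultiplication.OmegaCensus

end
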